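import Summits.QuantumFields.YangMills.Theorems.BalabanUVNodesN19TiltedPrice
import Summits.QuantumFields.YangMills.Theorems.BalabanUVNodesN19SourcedResponse

/-!
# YM-DAG node N19 (= NE7 proper) — THE TILTED PRICE, by-name faces of the EDGE price: NO WINDOW SHRINK (`Core l₀ ⇒ TiltedMeanMatching l₀`; the
# sourced response converges on the CLOSED source window with the Markov tail rate)

Cell `pub-ymgap`, HUMAN RULING D-0062 (Track A), R141 (C) wider-strategy seat `pub-ymgap-dag-n19-e` (strategy s3 = ALTERNATIVE CURRENCY), generation
g15, module 4 (after p527999 `…N19TiltedPriceGauges`, p528923 `…N19TiltedPrice`, p530176 `…N19TiltedPriceTwoSided`, all keyed on the ⁵ item).  Route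
`Summits/QuantumFields/YangMills/Theses/BalabanUVNodes.lean` rev 22 (commit 2d048f7e82a7), cluster item K3⁶ «SpineGivenEndpointR13SepCoPR»
(stmt-QuantumFields-20509; dag-lead WORDS-142); filed `--supports` that item `--as helper` (it proves no registered stub; the lineage is record-token-free).  COUNT-NEUTRAL: bookkeeping BY NAME over p528923
(`abs_tiltedMean_sub_le_edge_of_cgf_close` — Markov's price, uniform on the CLOSED window), p497552 `…N19MGFJoinConverse` (`neZero_or_eq_zero_of_sandwich`,
`tiltedMean_zero_measure`; its `tiltedMeanMatching_of_core` is the theorem un-shrunk here), p499283 `…N19SourcedResponse` (`deriv_genFun_schemeZ_eq_tiltedMean`;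
its `exists_tendsto_tiltedMean` ∕ `exists_tendsto_deriv_genFun_of_target` are the theorems extended to the edge), p482030 (`abs_genFun_add_sub_le_tail`),
p462782 `…N19CoreMetric` (`abs_log_sub_log_sub_le_of_sandwich`), `DressedMGFForm` (`MGFForm`, `TiltedMeanMatching`); NOT a discharge claim.

WHAT MARKOV BUYS.  Every tilted-mean theorem of the lineage so far (p497552 §2–§3, p499283 §1–§2) lives on an INNER window `|s| ≤ l₁ < l₀` with a
constant `1∕(l₀ − l₁)`, because the centre lemma needs room on both sides of the source.  p528923's edge theorem is uniform on `|s| ≤ l₀`.  Hence: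
§2 ★★ `tiltedMeanMatching_of_core_closedWindow` — MGF-form cores (`DressedMGFForm.MGFForm`, bound `B`) with the dressed core sandwich
`Spine.NE7.Core l₀ vol T Bad P Q δ` (`0 ≤ vol`, `0 ≤ δ`; classes good uniformly on the window) satisfy N14's binder `TiltedMeanMatching l₀ T Bad F ν F′ ν′ η`
ON THE PRODUCER'S OWN WINDOW `l₀`, `η_K = 64e^{2+2(2e−1)l₀B}·volδ_K·(1 + L_K)²∕(l₀·log²(e + L_K))`, `L_K = log⁺(2volδ_K)⁻¹` (p497552: window `l₁ < l₀`,
`η_K = 8e^{1+(l₀−l₁)B}volδ_K(1 + L_K)∕(l₀ − l₁)`); via `abs_tiltedMean_sub_le_edge_of_sandwich` (no mass hypothesis).  §3 in p499283's generic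
setting (probability spaces `μ K`, `|X K| ≤ B`, cgf's `τ_K`-close on `|t| ≤ l₀` for all later indices, `τ_K → 0`): ★ `exists_tendsto_tiltedMean_closedWindow`
— the tilted means converge at EVERY `|s| ≤ l₀` with `|tiltedMean (X K) (μ K) s − m s| ≤ Φ_K := 64e^{2+2(2e−1)l₀B}·τ_K·(1 + log⁺(2τ_K)⁻¹)²∕(l₀log²(e + log⁺(2τ_K)⁻¹))`,
and `tendstoUniformlyOn_tiltedMean_closedWindow` (§1: `Φ_K → 0`, from `x·(log⁺x⁻¹)² ≤ 16√x`).  §4 at the scheme under `Spine.NE7.Target vol l₀ δ (schemeZ S os)`: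
★ `exists_tendsto_deriv_genFun_of_target_closedWindow` — the sourced expectations `G_K′(s)` converge with the Markov tail rate (`τ_K = Σ_j 2volδ_{K+j}`, `B = 1`)
at every `|s| ≤ l₀`, THE EDGE `s = ±l₀` INCLUDED (p499283: `|s| ≤ l₁ < l₀` with rate; p501027: every source, no rate), and
`tendstoUniformlyOn_deriv_genFun_of_target_closedWindow` (uniformly on the closed window).

KERNEL-CHECKED (0 `def`, 0 `sorry`): §1 `mul_sq_posLog_inv_le`, `sqlogPrice_le`, `tendsto_sqlog_of_tendsto_zero` · §2 ★ `abs_tiltedMean_sub_le_edge_of_sandwich`,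
★★ `tiltedMeanMatching_of_core_closedWindow` · §3 `abs_tiltedMean_add_sub_le_edge`, ★ `exists_tendsto_tiltedMean_closedWindow`,
`tendstoUniformlyOn_tiltedMean_closedWindow` · §4 ★ `exists_tendsto_deriv_genFun_of_target_closedWindow`, `tendstoUniformlyOn_deriv_genFun_of_target_closedWindow`.
NOT claimed: summability of `η` (needs `Σ volδ_K·log²(…) < ∞`, true for geometric `δ` — not typed); one-sided differentiability of `genFunLim` AT `±l₀`
from these rates (p502271's real-analyticity of `genFunLim` on `ℝ` already gives differentiability there).

HONEST FRAMING (binding).  Bookkeeping; the located consumer (N14's `TiltedMeanMatching` binder) is already served on inner windows (p497552) — the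
same-window form is a convenience, not a need.  Nothing of [Balaban1987RG1]–[Balaban1989LargeFieldII] or [King1986] is asserted, quoted or instantiated;
`Core` ∕ `Target` are HYPOTHESES; NE7 ∕ NE7b ∕ NE7c NOT PRINTED, NOT proved; N19 NOT discharged; Track A count unmoved (typed 28∕28 · discharged 5∕27 ·
A 5∕28).  One finite `T⁴` programme at fixed `ε`; nothing continuum ∕ `ℝ⁴` ∕ OS ∕ mass-gap ∕ Clay.  THEOREMS ONLY; standard axioms; no cite tags.
-/

set_option autoImplicit false

noncomputable section

open Set Metric Filter Topology MeasureTheory ProbabilityTheory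

namespace Summit.QuantumFields.YangMills.Theorems.BalabanUVNodesN19TiltedPriceClosedWindow

open Literature.MathematicalPhysics.QuantumFieldTheory.Balaban1983to89
open T4CauchySum (MatchingModConstants genFun)
open T4GenFunBounds (schemeZ prodObs)
open Missing (TorusScheme)
open Summit.QuantumFields.BalabanUV.T4Continuum.Spine
open Summit.QuantumFields.BalabanUV.T4Continuum.NE1p.DressedMGFForm (tiltedMean MGFForm TiltedMeanMatching)
open Summit.QuantumFields.YangMills.BalabanUVNodes.N19MGFJoinConverse (neZero_or_eq_zero_of_sandwich tiltedMean_zero_measure)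
open Summit.QuantumFields.YangMills.BalabanUVNodes.N19CoreMetric (abs_log_sub_log_sub_le_of_sandwich)
open Summit.QuantumFields.YangMills.BalabanUVNodes.N19ExpectationCurrencyAtScheme (mul_nonneg_of_matchingModConstants)
open Summit.QuantumFields.YangMills.BalabanUVNodes.N19ExpectationCurrencyTwoConstantsRate (abs_genFun_add_sub_le_tail)
open Summit.QuantumFields.YangMills.BalabanUVNodes.N19SourcedResponse (deriv_genFun_schemeZ_eq_tiltedMean)
open Summit.QuantumFields.YangMills.Theorems.BalabanUVNodesN19TiltedPrice (abs_tiltedMean_sub_le_edge_of_cgf_close)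

/-! ## §1 The Markov price function tends to zero [folklore] -/

/-- `x·(log⁺x⁻¹)² ≤ 16·√x` for `x ≥ 0` (with `y = x^{1∕4}`: `log⁺x⁻¹ = 4·log y⁻¹ ≤ 4y⁻¹` on `0 < x < 1`). [folklore] -/
theorem mul_sq_posLog_inv_le {x : ℝ} (hx : 0 ≤ x) : x * Real.posLog x⁻¹ ^ 2 ≤ 16 * Real.sqrt x := by
  rcases hx.eq_or_lt with hx0 | hx0
  · rw [← hx0]; simp
  rcases le_or_gt 1 x with hx1 | hx1
  · have h0 : Real.posLog x⁻¹ = 0 := (Real.posLog_eq_zero_iff _).2 (by rw [abs_of_pos (inv_pos.2 hx0)]; exact inv_le_one_of_one_le₀ hx1)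
    rw [h0, zero_pow two_ne_zero, mul_zero]; positivity
  · set y : ℝ := Real.sqrt (Real.sqrt x) with hy
    have hy0 : 0 < y := by positivity
    have hy2 : y ^ 2 = Real.sqrt x := Real.sq_sqrt (Real.sqrt_nonneg _)
    have hy4 : y ^ 4 = x := by rw [show y ^ 4 = (y ^ 2) ^ 2 by ring, hy2, Real.sq_sqrt hx]
    have hy1 : y ≤ 1 := by
      rw [hy, Real.sqrt_le_one, Real.sqrt_le_one]; exact hx1.le
    have hL : Real.posLog x⁻¹ = 4 * Real.log y⁻¹ := by
      rw [Real.posLog_eq_log (by rw [abs_of_pos (inv_pos.2 hx0)]; exact (one_le_inv₀ hx0).2 hx1.le), Real.log_inv, Real.log_inv,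
        ← hy4, Real.log_pow]
      push_cast; ring
    have hlog : Real.log y⁻¹ ≤ y⁻¹ := (Real.log_le_sub_one_of_pos (inv_pos.2 hy0)).trans (by linarith)
    have hlog0 : 0 ≤ Real.log y⁻¹ := Real.log_nonneg ((one_le_inv₀ hy0).2 hy1)
    calc x * Real.posLog x⁻¹ ^ 2 = 16 * y ^ 2 * (y * Real.log y⁻¹) ^ 2 := by rw [hL, ← hy4]; ring
      _ ≤ 16 * y ^ 2 * (y * y⁻¹) ^ 2 := by gcongr
      _ = 16 * Real.sqrt x := by rw [mul_inv_cancel₀ hy0.ne', hy2]; ring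

/-- The Markov price is at most `2C·(x + 16√(2x))`: `C·x·(1 + log⁺(2x)⁻¹)²∕log²(e + log⁺(2x)⁻¹) ≤ C·(2x + 32√(2x))` (`0 ≤ x`, `0 ≤ C`). [folklore] -/
theorem sqlogPrice_le {x C : ℝ} (hx : 0 ≤ x) (hC : 0 ≤ C) :
    C * x * (1 + Real.posLog (2 * x)⁻¹) ^ 2 / Real.log (Real.exp 1 + Real.posLog (2 * x)⁻¹) ^ 2 ≤ C * (2 * x + 32 * Real.sqrt (2 * x)) := by
  set L := Real.posLog (2 * x)⁻¹ with hL
  have hL0 : 0 ≤ L := Real.posLog_nonneg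
  have hlog1 : 1 ≤ Real.log (Real.exp 1 + L) := by rw [Real.le_log_iff_exp_le (by positivity)]; linarith
  have hsq := mul_sq_posLog_inv_le (x := 2 * x) (by positivity)
  calc C * x * (1 + L) ^ 2 / Real.log (Real.exp 1 + L) ^ 2 ≤ C * x * (1 + L) ^ 2 / 1 := by
        gcongr; exact one_le_pow₀ hlog1
    _ = C * (x * (1 + L) ^ 2) := by ring
    _ ≤ C * (2 * x + 32 * Real.sqrt (2 * x)) := by
        refine mul_le_mul_of_nonneg_left ?_ hC
        have h1 : x * L ^ 2 ≤ 8 * Real.sqrt (2 * x) := by linarith [hsq]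
        have h2 : 2 * x * L ≤ x + x * L ^ 2 := by nlinarith [mul_nonneg hx (sq_nonneg (L - 1))]
        have h3 : 0 ≤ Real.sqrt (2 * x) := Real.sqrt_nonneg _
        nlinarith [h1, h2, h3]

/-- If `0 ≤ u_K → 0` then `C·u_K·(1 + log⁺(2u_K)⁻¹)²∕log²(e + log⁺(2u_K)⁻¹) → 0`. [folklore] -/
theorem tendsto_sqlog_of_tendsto_zero {u : ℕ → ℝ} (hu0 : ∀ K, 0 ≤ u K) (hu : Tendsto u atTop (𝓝 0)) {C : ℝ} (hC : 0 ≤ C) :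
    Tendsto (fun K => C * u K * (1 + Real.posLog (2 * u K)⁻¹) ^ 2 / Real.log (Real.exp 1 + Real.posLog (2 * u K)⁻¹) ^ 2) atTop (𝓝 0) := by
  have hg : Tendsto (fun K => C * (2 * u K + 32 * Real.sqrt (2 * u K))) atTop (𝓝 0) := by
    have h2 : Tendsto (fun K => 2 * u K) atTop (𝓝 0) := by simpa using hu.const_mul 2
    have hs : Tendsto (fun K => Real.sqrt (2 * u K)) atTop (𝓝 0) := by
      have := (Real.continuous_sqrt.tendsto 0).comp h2
      rwa [Function.comp_def, Real.sqrt_zero] at this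
    simpa using (h2.add (hs.const_mul 32)).const_mul C
  refine squeeze_zero (fun K => ?_) (fun K => sqlogPrice_le (hu0 K) hC) hg
  have : 0 ≤ Real.posLog (2 * u K)⁻¹ := Real.posLog_nonneg
  have := hu0 K
  positivity

/-! ## §2 One class, two runs: the MGF sandwich pays the tilted means on the WHOLE window; `Core l₀ ⇒ TiltedMeanMatching l₀` -/

section Sandwich

variable {Ω Ω' : Type*} {mΩ : MeasurableSpace Ω} {mΩ' : MeasurableSpace Ω'} {ν : Measure Ω} {ν' : Measure Ω'}
  [IsFiniteMeasure ν] [IsFiniteMeasure ν'] {F : Ω → ℝ} {F' : Ω' → ℝ} {B : ℝ}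

/-- **THE MGF SANDWICH ⇒ CLOSE TILTED MEANS ON THE WHOLE WINDOW, MARKOV PRICE** [folklore].  `ν`, `ν′` finite (NO mass hypothesis), `F`, `F′`
measurable with `|F|, |F′| ≤ B`; if `e^{c−ε}·mgf F ν u ≤ mgf F′ ν′ u ≤ e^{c+ε}·mgf F ν u` for `|u| ≤ l₀` (`0 ≤ ε`, `0 < l₀`), then for EVERY `|s| ≤ l₀`:
`|tiltedMean F′ ν′ s − tiltedMean F ν s| ≤ 64e^{2+2(2e−1)l₀B}·ε·(1 + log⁺(2ε)⁻¹)²∕(l₀·log²(e + log⁺(2ε)⁻¹))` (p528923's edge theorem; the `|s|` in its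
exponent bounded by `l₀`). -/
theorem abs_tiltedMean_sub_le_edge_of_sandwich (hFm : Measurable F) (hF : ∀ ω, |F ω| ≤ B)
    (hFm' : Measurable F') (hF' : ∀ ω, |F' ω| ≤ B) {c ε l₀ : ℝ} (hl₀ : 0 < l₀) (hε0 : 0 ≤ ε)
    (h : ∀ u : ℝ, |u| ≤ l₀ →
      Real.exp (c - ε) * mgf F ν u ≤ mgf F' ν' u ∧ mgf F' ν' u ≤ Real.exp (c + ε) * mgf F ν u)
    {s : ℝ} (hs : |s| ≤ l₀) :
    |tiltedMean F' ν' s - tiltedMean F ν s| ≤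
      64 * Real.exp (2 + 2 * (2 * Real.exp 1 - 1) * l₀ * B) * ε * (1 + Real.posLog (2 * ε)⁻¹) ^ 2 /
        (l₀ * Real.log (Real.exp 1 + Real.posLog (2 * ε)⁻¹) ^ 2) := by
  have hpl : 0 ≤ Real.posLog (2 * ε)⁻¹ := Real.posLog_nonneg
  rcases neZero_or_eq_zero_of_sandwich (ν := ν) (ν' := ν') hFm hF (h 0 (by simpa using hl₀.le)) with ⟨hν, hν'⟩ | ⟨hν, hν'⟩
  · rw [hν, hν', tiltedMean_zero_measure, tiltedMean_zero_measure, sub_zero, abs_zero]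
    positivity
  · haveI := hν
    have hB : 0 ≤ B := T4GenFunBounds.nonneg_of_ae_abs_le (NeZero.ne ν) (ae_of_all _ hF)
    have hclose : ∀ u : ℝ, |u| ≤ l₀ → |cgf F' ν' u - cgf F ν u - c| ≤ ε := fun u hu =>
      abs_log_sub_log_sub_le_of_sandwich (T4GenFunBounds.mgf_pos_of_abs_le hFm.aemeasurable (ae_of_all _ hF) u) (h u hu).1 (h u hu).2
    have key := abs_tiltedMean_sub_le_edge_of_cgf_close hFm.aemeasurable (ae_of_all _ hF) hFm'.aemeasurable (ae_of_all _ hF') hl₀ hε0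
      hclose hs
    refine key.trans ?_
    have hprod : 0 ≤ (2 * Real.exp 1 - 1) * ((l₀ - |s|) * B) :=
      mul_nonneg (by linarith [Real.add_one_le_exp (1 : ℝ)]) (mul_nonneg (sub_nonneg.2 hs) hB)
    have hexp : Real.exp (2 + (2 * Real.exp 1 - 1) * (l₀ + |s|) * B) ≤ Real.exp (2 + 2 * (2 * Real.exp 1 - 1) * l₀ * B) :=
      Real.exp_le_exp.2 (by nlinarith [hprod])
    gcongr 64 * ?_ * ε * _ / _

end Sandwich

section Leaf

variable {ι : Type*} [DecidableEq ι] {Ω Ω' : ℕ → Type*} [∀ K, MeasurableSpace (Ω K)] [∀ K, MeasurableSpace (Ω' K)]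
  {B l₀ vol : ℝ} {T : ℕ → Finset ι} {Bad : ℕ → ℝ → Finset ι} {F : ∀ K, Ω K → ℝ} {ν : ∀ K, ι → Measure (Ω K)}
  {F' : ∀ K, Ω' K → ℝ} {ν' : ∀ K, ι → Measure (Ω' K)} {P Q : ℕ → ℝ → ι → ℝ} {δ : ℕ → ℝ}

/-- ★★ **`Core` ON THE WINDOW `l₀` ⇒ `TiltedMeanMatching` ON THE SAME WINDOW `l₀` (NO SHRINK), MARKOV PRICE.**  Shell-free cores `P` (run A) and
`Q` (run B) in MGF form (`DressedMGFForm.MGFForm`, bound `B`), the dressed core sandwich `NE7.Core l₀ vol T Bad P Q δ` (`0 < l₀`, `0 ≤ vol`, `0 ≤ δ`),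
classes good uniformly on the window (`Bad K u ⊆ Bad K t` for `|t|, |u| ≤ l₀`); then N14's binder holds at the producer's own window:
`TiltedMeanMatching l₀ T Bad F ν F′ ν′ η`, `η K = 64e^{2+2(2e−1)l₀B}·volδ_K·(1 + log⁺(2volδ_K)⁻¹)²∕(l₀·log²(e + log⁺(2volδ_K)⁻¹))`
— p497552's `tiltedMeanMatching_of_core` gave the inner windows `l₁ < l₀` at the lin-log price `∕(l₀ − l₁)`. [folklore] -/
theorem tiltedMeanMatching_of_core_closedWindow (hP : MGFForm B T F ν P) (hQ : MGFForm B T F' ν' Q) (h : NE7.Core l₀ vol T Bad P Q δ)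
    (hl₀ : 0 < l₀) (hvol : 0 ≤ vol) (hδ : ∀ K, 0 ≤ δ K)
    (hBad : ∀ K (t u : ℝ), |t| ≤ l₀ → |u| ≤ l₀ → Bad K u ⊆ Bad K t) :
    TiltedMeanMatching l₀ T Bad F ν F' ν' fun K =>
      64 * Real.exp (2 + 2 * (2 * Real.exp 1 - 1) * l₀ * B) * (vol * δ K) * (1 + Real.posLog (2 * (vol * δ K))⁻¹) ^ 2 /
        (l₀ * Real.log (Real.exp 1 + Real.posLog (2 * (vol * δ K))⁻¹) ^ 2) := by
  intro K t ht τ hτ s hs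
  obtain ⟨c, hc⟩ := h K
  have hτT : τ ∈ T K := (Finset.mem_sdiff.mp hτ).1
  haveI := hP.finite K τ hτT
  haveI := hQ.finite K τ hτT
  refine abs_tiltedMean_sub_le_edge_of_sandwich (hP.meas K) (hP.bound K) (hQ.meas K) (hQ.bound K) hl₀
    (mul_nonneg hvol (hδ K)) (c := c) (fun u hu => ?_) hs
  have hτu : τ ∈ T K \ Bad K u := by
    rw [Finset.mem_sdiff] at hτ ⊢
    exact ⟨hτ.1, fun hb => hτ.2 (hBad K t u ht hu hb)⟩
  have key := hc u hu τ hτu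
  rwa [hP.repr K u τ hτT, hQ.repr K u τ hτT] at key

end Leaf

/-! ## §3 A sequence of probability spaces: tilted means converge on the CLOSED window with the Markov tail rate -/

section Generic

variable {Ω : ℕ → Type*} [∀ K, MeasurableSpace (Ω K)] {μ : ∀ K, Measure (Ω K)} [∀ K, IsProbabilityMeasure (μ K)]
  {X : ∀ K, Ω K → ℝ} {B l₀ : ℝ} {τ : ℕ → ℝ}

/-- **THE PAIR `(K, K+n)` AT EVERY TILT OF THE CLOSED WINDOW, UNIFORMLY IN `n`** [folklore].  Probability measures `μ K`, observables `|X K| ≤ B`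
measurable; if `|cgf (X (K+n)) (μ (K+n)) t − cgf (X K) (μ K) t| ≤ τ K` on `|t| ≤ l₀` (`0 < l₀`, `0 ≤ τ`), then for every `|s| ≤ l₀`
`|tiltedMean (X (K+n)) (μ (K+n)) s − tiltedMean (X K) (μ K) s| ≤ 64e^{2+2(2e−1)l₀B}·τ_K·(1 + log⁺(2τ_K)⁻¹)²∕(l₀·log²(e + log⁺(2τ_K)⁻¹))`. -/
theorem abs_tiltedMean_add_sub_le_edge (hXm : ∀ K, Measurable (X K)) (hX : ∀ K ω, |X K ω| ≤ B) (hl₀ : 0 < l₀) (hτ0 : ∀ K, 0 ≤ τ K)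
    (hτ : ∀ K n (t : ℝ), |t| ≤ l₀ → |cgf (X (K + n)) (μ (K + n)) t - cgf (X K) (μ K) t| ≤ τ K)
    (K n : ℕ) {s : ℝ} (hs : |s| ≤ l₀) :
    |tiltedMean (X (K + n)) (μ (K + n)) s - tiltedMean (X K) (μ K) s| ≤
      64 * Real.exp (2 + 2 * (2 * Real.exp 1 - 1) * l₀ * B) * τ K * (1 + Real.posLog (2 * τ K)⁻¹) ^ 2 /
        (l₀ * Real.log (Real.exp 1 + Real.posLog (2 * τ K)⁻¹) ^ 2) := by
  have hB : 0 ≤ B := T4GenFunBounds.nonneg_of_ae_abs_le (IsProbabilityMeasure.ne_zero (μ K)) (ae_of_all _ (hX K))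
  have key := abs_tiltedMean_sub_le_edge_of_cgf_close (ν := μ K) (ν' := μ (K + n)) (hXm K).aemeasurable (ae_of_all _ (hX K))
    (hXm (K + n)).aemeasurable (ae_of_all _ (hX (K + n))) hl₀ (hτ0 K) (c := 0) (fun u hu => by simpa using hτ K n u hu) hs
  refine key.trans ?_
  have hprod : 0 ≤ (2 * Real.exp 1 - 1) * ((l₀ - |s|) * B) :=
    mul_nonneg (by linarith [Real.add_one_le_exp (1 : ℝ)]) (mul_nonneg (sub_nonneg.2 hs) hB)
  have hexp : Real.exp (2 + (2 * Real.exp 1 - 1) * (l₀ + |s|) * B) ≤ Real.exp (2 + 2 * (2 * Real.exp 1 - 1) * l₀ * B) :=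
    Real.exp_le_exp.2 (by nlinarith [hprod])
  have := hτ0 K
  gcongr 64 * ?_ * τ K * _ / _

/-- ★ **TILTED MEANS CONVERGE AT EVERY TILT OF THE CLOSED WINDOW, WITH THE MARKOV TAIL RATE** [folklore]: if moreover `τ_K → 0`, then for every
`|s| ≤ l₀` (the edge included) the tilted means converge to a limit `m s` and
`|tiltedMean (X K) (μ K) s − m s| ≤ 64e^{2+2(2e−1)l₀B}·τ_K·(1 + log⁺(2τ_K)⁻¹)²∕(l₀·log²(e + log⁺(2τ_K)⁻¹))` for EVERY `K`. -/
theorem exists_tendsto_tiltedMean_closedWindow (hXm : ∀ K, Measurable (X K)) (hX : ∀ K ω, |X K ω| ≤ B) (hl₀ : 0 < l₀) (hτ0 : ∀ K, 0 ≤ τ K)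
    (hτ : ∀ K n (t : ℝ), |t| ≤ l₀ → |cgf (X (K + n)) (μ (K + n)) t - cgf (X K) (μ K) t| ≤ τ K)
    (hτlim : Tendsto τ atTop (𝓝 0)) :
    ∃ m : ℝ → ℝ, ∀ s : ℝ, |s| ≤ l₀ → Tendsto (fun K => tiltedMean (X K) (μ K) s) atTop (𝓝 (m s)) ∧
      ∀ K, |tiltedMean (X K) (μ K) s - m s| ≤
        64 * Real.exp (2 + 2 * (2 * Real.exp 1 - 1) * l₀ * B) * τ K * (1 + Real.posLog (2 * τ K)⁻¹) ^ 2 /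
          (l₀ * Real.log (Real.exp 1 + Real.posLog (2 * τ K)⁻¹) ^ 2) := by
  set C : ℝ := 64 * Real.exp (2 + 2 * (2 * Real.exp 1 - 1) * l₀ * B) / l₀ with hC
  have hC0 : 0 ≤ C := by positivity
  set Φ : ℕ → ℝ := fun K => 64 * Real.exp (2 + 2 * (2 * Real.exp 1 - 1) * l₀ * B) * τ K * (1 + Real.posLog (2 * τ K)⁻¹) ^ 2 /
    (l₀ * Real.log (Real.exp 1 + Real.posLog (2 * τ K)⁻¹) ^ 2) with hΦ
  have hΦlim : Tendsto Φ atTop (𝓝 0) := by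
    refine (tendsto_sqlog_of_tendsto_zero hτ0 hτlim hC0).congr fun K => ?_
    simp only [hΦ, hC]
    field_simp
  have hpair : ∀ K n (s : ℝ), |s| ≤ l₀ → |tiltedMean (X (K + n)) (μ (K + n)) s - tiltedMean (X K) (μ K) s| ≤ Φ K :=
    fun K n s hs => abs_tiltedMean_add_sub_le_edge hXm hX hl₀ hτ0 hτ K n hs
  have hc : ∀ s : ℝ, |s| ≤ l₀ → CauchySeq fun K => tiltedMean (X K) (μ K) s := fun s hs => by
    refine Metric.cauchySeq_iff'.2 fun ε hε => ?_
    obtain ⟨N, hN⟩ := (hΦlim.eventually (Iio_mem_nhds hε)).exists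
    refine ⟨N, fun n hn => ?_⟩
    obtain ⟨k, rfl⟩ := Nat.exists_eq_add_of_le hn
    rw [Real.dist_eq]
    exact (hpair N k s hs).trans_lt hN
  refine ⟨fun s => limUnder atTop fun K => tiltedMean (X K) (μ K) s, fun s hs => ?_⟩
  have hE := (hc s hs).tendsto_limUnder
  refine ⟨hE, fun K => ?_⟩
  set E := limUnder atTop fun K => tiltedMean (X K) (μ K) s
  have hEK : Tendsto (fun n => tiltedMean (X (K + n)) (μ (K + n)) s) atTop (𝓝 E) := by
    have h := (tendsto_add_atTop_iff_nat (f := fun j => tiltedMean (X j) (μ j) s) K).2 hE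
    have e : (fun n => tiltedMean (X (n + K)) (μ (n + K)) s) = fun n => tiltedMean (X (K + n)) (μ (K + n)) s := by
      funext n; rw [add_comm]
    rwa [e] at h
  have habs : Tendsto (fun n => |tiltedMean (X (K + n)) (μ (K + n)) s - tiltedMean (X K) (μ K) s|) atTop
      (𝓝 |E - tiltedMean (X K) (μ K) s|) := (hEK.sub_const _).abs
  rw [abs_sub_comm]
  exact le_of_tendsto' habs fun n => hpair K n s hs

/-- **… UNIFORMLY ON THE CLOSED WINDOW** [folklore]: the convergence of the tilted means is uniform on `{s | |s| ≤ l₀}`. -/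
theorem tendstoUniformlyOn_tiltedMean_closedWindow (hXm : ∀ K, Measurable (X K)) (hX : ∀ K ω, |X K ω| ≤ B) (hl₀ : 0 < l₀)
    (hτ0 : ∀ K, 0 ≤ τ K) (hτ : ∀ K n (t : ℝ), |t| ≤ l₀ → |cgf (X (K + n)) (μ (K + n)) t - cgf (X K) (μ K) t| ≤ τ K)
    (hτlim : Tendsto τ atTop (𝓝 0)) :
    TendstoUniformlyOn (fun K s => tiltedMean (X K) (μ K) s) (fun s => limUnder atTop fun K => tiltedMean (X K) (μ K) s) atTop
      {s | |s| ≤ l₀} := by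
  obtain ⟨m, hm⟩ := exists_tendsto_tiltedMean_closedWindow hXm hX hl₀ hτ0 hτ hτlim
  have hlim : ∀ s : ℝ, |s| ≤ l₀ → (limUnder atTop fun K => tiltedMean (X K) (μ K) s) = m s :=
    fun s hs => (hm s hs).1.limUnder_eq
  set C : ℝ := 64 * Real.exp (2 + 2 * (2 * Real.exp 1 - 1) * l₀ * B) / l₀ with hC
  have hC0 : 0 ≤ C := by positivity
  have hΦlim : Tendsto (fun K => 64 * Real.exp (2 + 2 * (2 * Real.exp 1 - 1) * l₀ * B) * τ K * (1 + Real.posLog (2 * τ K)⁻¹) ^ 2 /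
      (l₀ * Real.log (Real.exp 1 + Real.posLog (2 * τ K)⁻¹) ^ 2)) atTop (𝓝 0) := by
    refine (tendsto_sqlog_of_tendsto_zero hτ0 hτlim hC0).congr fun K => ?_
    simp only [hC]
    field_simp
  rw [Metric.tendstoUniformlyOn_iff]
  intro ε hε
  filter_upwards [hΦlim.eventually (Iio_mem_nhds hε)] with K hK s hs
  rw [hlim s hs, Real.dist_eq, abs_sub_comm]
  exact ((hm s hs).2 K).trans_lt hK

end Generic

/-! ## §4 At the scheme: sourced expectations converge on the CLOSED source window, with the Markov tail rate, under `Target` alone -/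

section Scheme

variable {G : Type*} [GaugeGroup G] [MeasurableSpace G] [RegularGaugeGroup G] [HaarData G] {O : Type*}
  (S : TorusScheme G O) (hβ : ∀ K, 0 ≤ S.β K) (hm : ∀ K o, Measurable (S.obs K o))
  (h1 : ∀ K o U, |S.obs K o U| ≤ 1)
include hβ hm h1

/-- ★ **SOURCED EXPECTATIONS CONVERGE ON THE CLOSED SOURCE WINDOW WITH THE MARKOV TAIL RATE, UNDER `Target` ALONE.**  If a string's dressed partition
functions carry `Spine.NE7.Target vol l₀ δ (schemeZ S os)` (`0 < l₀`), then there is `m : ℝ → ℝ` with, for ALL `|s| ≤ l₀` (the edge `s = ±l₀` included):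
`G_K′(s) → m s` and `|G_K′(s) − m s| ≤ (64e^{2+2(2e−1)l₀}∕l₀)·τ_K·(1 + log⁺(2τ_K)⁻¹)²∕log²(e + log⁺(2τ_K)⁻¹)` for EVERY `K`, `τ_K = Σ_j 2·vol·δ_{K+j}` —
p499283's `exists_tendsto_deriv_genFun_of_target` on `|s| ≤ l₁ < l₀` reaches the edge at Markov's price.  `Target` is a HYPOTHESIS. [folklore] -/
theorem exists_tendsto_deriv_genFun_of_target_closedWindow {vol l₀ : ℝ} {δ : ℕ → ℝ} (hl₀ : 0 < l₀) (os : List O)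
    (hT : NE7.Target vol l₀ δ (schemeZ S os)) :
    ∃ m : ℝ → ℝ, ∀ s : ℝ, |s| ≤ l₀ → Tendsto (fun K => deriv (genFun (schemeZ S os) K) s) atTop (𝓝 (m s)) ∧
      ∀ K, |deriv (genFun (schemeZ S os) K) s - m s| ≤
        64 * Real.exp (2 + 2 * (2 * Real.exp 1 - 1) * l₀) * (∑' j, 2 * (vol * δ (K + j))) *
            (1 + Real.posLog (2 * ∑' j, 2 * (vol * δ (K + j)))⁻¹) ^ 2 /
          (l₀ * Real.log (Real.exp 1 + Real.posLog (2 * ∑' j, 2 * (vol * δ (K + j)))⁻¹) ^ 2) := by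
  obtain ⟨hM, hδ⟩ := hT
  haveI hP : ∀ K, IsProbabilityMeasure (T4GenFunBounds.gibbsMeasure (G := G) (S.P K) (S.β K)) := fun K =>
    T4GenFunBounds.isProbabilityMeasure_gibbsMeasure (G := G) (S.P K) (hβ K)
  have hτ0 : ∀ K, 0 ≤ ∑' j, 2 * (vol * δ (K + j)) := fun K =>
    tsum_nonneg fun j => mul_nonneg two_pos.le (mul_nonneg_of_matchingModConstants hl₀.le hM (K + j))
  have hτlim : Tendsto (fun K => ∑' j, 2 * (vol * δ (K + j))) atTop (𝓝 0) := by
    have h := tendsto_sum_nat_add fun j => 2 * (vol * δ j)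
    refine h.congr fun i => tsum_congr fun k => by rw [add_comm]
  have hτ : ∀ K n (t : ℝ), |t| ≤ l₀ →
      |cgf (prodObs S (K + n) os) (T4GenFunBounds.gibbsMeasure (S.P (K + n)) (S.β (K + n))) t -
        cgf (prodObs S K os) (T4GenFunBounds.gibbsMeasure (S.P K) (S.β K)) t| ≤ ∑' j, 2 * (vol * δ (K + j)) := fun K n t ht => by
    rw [← T4GenFunBounds.genFun_schemeZ_eq_cgf S hβ hm h1, ← T4GenFunBounds.genFun_schemeZ_eq_cgf S hβ hm h1]
    exact abs_genFun_add_sub_le_tail hM hl₀.le hδ ht K n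
  obtain ⟨m, hm'⟩ := exists_tendsto_tiltedMean_closedWindow (μ := fun K => T4GenFunBounds.gibbsMeasure (S.P K) (S.β K))
    (X := fun K => prodObs S K os) (fun K => T4GenFunBounds.measurable_prodObs S hm K os)
    (fun K => T4GenFunBounds.abs_prodObs_le_one S h1 K os) hl₀ hτ0 hτ hτlim
  refine ⟨m, fun s hs => ?_⟩
  obtain ⟨hlim, hrate⟩ := hm' s hs
  refine ⟨?_, fun K => ?_⟩
  · simpa only [deriv_genFun_schemeZ_eq_tiltedMean S hβ hm h1] using hlim
  · simpa only [deriv_genFun_schemeZ_eq_tiltedMean S hβ hm h1, mul_one] using hrate K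

/-- **… UNIFORMLY ON THE CLOSED WINDOW**: under `Target`, the sourced expectations `s ↦ G_K′(s)` converge UNIFORMLY on `{s | |s| ≤ l₀}`. [folklore] -/
theorem tendstoUniformlyOn_deriv_genFun_of_target_closedWindow {vol l₀ : ℝ} {δ : ℕ → ℝ} (hl₀ : 0 < l₀) (os : List O)
    (hT : NE7.Target vol l₀ δ (schemeZ S os)) :
    TendstoUniformlyOn (fun K s => deriv (genFun (schemeZ S os) K) s)
      (fun s => limUnder atTop fun K => deriv (genFun (schemeZ S os) K) s) atTop {s | |s| ≤ l₀} := by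
  obtain ⟨hM, hδ⟩ := hT
  haveI hP : ∀ K, IsProbabilityMeasure (T4GenFunBounds.gibbsMeasure (G := G) (S.P K) (S.β K)) := fun K =>
    T4GenFunBounds.isProbabilityMeasure_gibbsMeasure (G := G) (S.P K) (hβ K)
  have hτ0 : ∀ K, 0 ≤ ∑' j, 2 * (vol * δ (K + j)) := fun K =>
    tsum_nonneg fun j => mul_nonneg two_pos.le (mul_nonneg_of_matchingModConstants hl₀.le hM (K + j))
  have hτlim : Tendsto (fun K => ∑' j, 2 * (vol * δ (K + j))) atTop (𝓝 0) := by
    have h := tendsto_sum_nat_add fun j => 2 * (vol * δ j)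
    refine h.congr fun i => tsum_congr fun k => by rw [add_comm]
  have hτ : ∀ K n (t : ℝ), |t| ≤ l₀ →
      |cgf (prodObs S (K + n) os) (T4GenFunBounds.gibbsMeasure (S.P (K + n)) (S.β (K + n))) t -
        cgf (prodObs S K os) (T4GenFunBounds.gibbsMeasure (S.P K) (S.β K)) t| ≤ ∑' j, 2 * (vol * δ (K + j)) := fun K n t ht => by
    rw [← T4GenFunBounds.genFun_schemeZ_eq_cgf S hβ hm h1, ← T4GenFunBounds.genFun_schemeZ_eq_cgf S hβ hm h1]
    exact abs_genFun_add_sub_le_tail hM hl₀.le hδ ht K n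
  have hU := tendstoUniformlyOn_tiltedMean_closedWindow (μ := fun K => T4GenFunBounds.gibbsMeasure (S.P K) (S.β K))
    (X := fun K => prodObs S K os) (fun K => T4GenFunBounds.measurable_prodObs S hm K os)
    (fun K => T4GenFunBounds.abs_prodObs_le_one S h1 K os) hl₀ hτ0 hτ hτlim
  have e : ∀ K s, tiltedMean (prodObs S K os) (T4GenFunBounds.gibbsMeasure (S.P K) (S.β K)) s = deriv (genFun (schemeZ S os) K) s :=
    fun K s => (deriv_genFun_schemeZ_eq_tiltedMean S hβ hm h1 K os s).symm
  simpa only [e] using hU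

end Scheme

end Summit.QuantumFields.YangMills.Theorems.BalabanUVNodesN19TiltedPriceClosedWindow

end
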